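import Literature.Probability.RandomPlanarGeometry.SAWSphereCover
import Literature.Probability.RandomPlanarGeometry.SAWLanes
import Literature.Probability.RandomPlanarGeometry.SAWRingRoutes
import Literature.Probability.RandomPlanarGeometry.SAWTileConnectors
import Literature.Probability.RandomPlanarGeometry.SAWPolygonOpening
import HarnessLib

/-!
# The spliced walk: inserting the merged excursion into a self-avoiding walk at the sphere

Assembly of the local surgery replacing the link polygon of H. Duminil-Copin, G. Kozma,
A. Yadin, *Supercritical self-avoiding walks are space-filling*, Ann. IHP Probab. Stat. 50
(2014), §3 (proof of Proposition 7: "`f(γ₁, γ₂) = γ₁ Δ ℓ(γ₁) Δ γ₂` … is in `Γ`"). Data: a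
self-avoiding vertex list `l`, a template `T` at the centre `z₀ = L t'` of the empty tile `t'`
(`SAWSphereCover.lean`), the side `dp` of `t'` carrying the port of the structure, and the
structure `S` (a self-avoiding list from `portA (t'+dp) (-dp)` to `portB (t'+dp) (-dp)`, e.g. the
merged excursion `OddTile.mergeList`). Construction (`Splice.newList`): the lane frame
(`Splice.laneFrame`: the template frame or its transpose, so that the lane pair lies in the
closed positive quadrant below the anchor), the lanes (`SAWLanes.lean`) down to the top row of
the arena of `t'` expressed in the lane frame (`Splice.rect`, `Frame.fr_mem_arena_iff`), the
two boundary routes (`SAWRingRoutes.lean`) from the arrivals to the two sites facing the port,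
the structure in between, the template tail; the stretch `g :: mid ++ [s₂]` of `l` is replaced
by `g :: (excursion) ++ tail ++ [s₂]` (in the direction in which it occurs in `l`).
`Splice.newList_mem` proves that the result is again a self-avoiding list in the domain with
the same endpoints, with `(|l|-1) + |S| ≤ |new| - 1 ≤ (|l|-1) + |S| + Kov`
(`Splice.length_newList`), under the hypotheses collected in `Splice.Hyp`.
-/

noncomputable section

open Finset Literature.Probability.LatticeModels

namespace Literature.Probability.RandomPlanarGeometry.SAW

/-! ### The arena in frame coordinates -/

namespace Frame

/-- The axis vector points in a positive coordinate direction. [folklore] -/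
def AxPos (e : Site 2) : Prop := e = pt 1 0 ∨ e = pt 0 1

/-- Lower frame bound of the arena along an axis: `-(A+1)` for a positive axis, `-A` for a
negative one (the arena `[L t'ᵢ - (A+1), L t'ᵢ + A]²` is off-centre by one half). [folklore] -/
def axLo (A : ℤ) (e : Site 2) : ℤ := by
  classical
  exact if AxPos e then -(A + 1) else -A

/-- **The arena in frame coordinates**: for a frame centred at the tile centre `L t'`,
`fr a b ∈ arena t'` iff `axLo A ex ≤ a ≤ axLo A ex + 2A + 1` and likewise for `b`, where
`A = h + r`. [folklore] -/
theorem fr_mem_arena_iff {m r : ℕ} (F : Frame) {t' : Site 2} (hz : F.z₀ = OddTile.ctr m r t') (a b : ℤ) :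
    F.fr a b ∈ OddTile.arena m r t' ↔
      axLo (OddTile.hw m r + r) F.ex ≤ a ∧ a ≤ axLo (OddTile.hw m r + r) F.ex + 2 * (OddTile.hw m r + r) + 1 ∧
      axLo (OddTile.hw m r + r) F.ey ≤ b ∧ b ≤ axLo (OddTile.hw m r + r) F.ey + 2 * (OddTile.hw m r + r) + 1 := by
  classical
  rw [OddTile.mem_arena_iff, Fin.forall_fin_two]
  simp only [fr_apply, hz, OddTile.ctr_apply]
  have hne1 : ¬AxPos (pt (-1) 0) := by simp [AxPos, site_eq_iff]
  have hne2 : ¬AxPos (pt 0 (-1)) := by simp [AxPos, site_eq_iff]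
  have hp1 : AxPos (pt 1 0) := Or.inl rfl
  have hp2 : AxPos (pt 0 1) := Or.inr rfl
  rcases F.valid with ⟨h1, h2 | h2⟩ | ⟨h1, h2 | h2⟩ | ⟨h1, h2 | h2⟩ | ⟨h1, h2 | h2⟩ <;>
    simp only [h1, h2, axLo, hp1, hp2, hne1, hne2, if_true, if_false, pt_apply_zero, pt_apply_one,
      mul_one, mul_zero, mul_neg, add_zero] <;> omega

end Frame

/-! ### Adjacent boundary sites of a rectangle are consecutive on its cycle -/

namespace Rect

/-- In a rectangle at least `2` wide and `2` high, two lattice-adjacent boundary sites are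
consecutive on the boundary cycle. [folklore] -/
theorem idx_of_adj (Q : Rect) (hW : 2 ≤ Q.W) (hH : 2 ≤ Q.H) {X Y : Site 2} (hX : Q.OnBdry X)
    (hY : Q.OnBdry Y) (h : (zdGraph 2).Adj X Y) :
    Q.idx Y ≡ Q.idx X + 1 [ZMOD Q.P] ∨ Q.idx X ≡ Q.idx Y + 1 [ZMOD Q.P] := by
  have := Q.hx; have := Q.hy
  rw [Q.F.adj_iff_frame] at h
  obtain ⟨x1, x2, x3, x4, x5⟩ := hX
  obtain ⟨y1, y2, y3, y4, y5⟩ := hY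
  -- either the indices differ by exactly one, or it is the wrap-around at the top-left corner
  have key : Q.idx Y = Q.idx X + 1 ∨ Q.idx X = Q.idx Y + 1 ∨
      (Q.idx X = 0 ∧ Q.idx Y = Q.P - 1) ∨ (Q.idx Y = 0 ∧ Q.idx X = Q.P - 1) := by
    simp only [idx, P, W, H] at *
    split_ifs <;> omega
  rcases key with k | k | ⟨k1, k2⟩ | ⟨k1, k2⟩
  · exact Or.inl (by rw [k])
  · exact Or.inr (by rw [k])
  · right
    rw [k1, k2, Int.modEq_iff_dvd]
    exact ⟨1, by ring⟩
  · left
    rw [k1, k2, Int.modEq_iff_dvd]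
    exact ⟨1, by ring⟩

end Rect

/-! ### The data of the splice -/

namespace Splice

variable {m r : ℕ}

/-- The lane frame of a template: its own frame if the anchor's ordinate dominates, the
transposed frame otherwise (so that the anchor is "north-dominant" and the lane pair lies in
the closed positive quadrant). [folklore] -/
def laneFrame (T : Template) : Frame := if T.p ≤ T.q then T.F else T.F.swap

/-- The lane abscissa in the lane frame. [folklore] -/
def lα (T : Template) : ℤ := if T.p ≤ T.q then T.α else T.β

/-- The lane ordinate in the lane frame. [folklore] -/
def lβ (T : Template) : ℤ := if T.p ≤ T.q then T.β else T.α

/-- The lane frame has the centre of the template frame. [folklore] -/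
@[simp] theorem laneFrame_z₀ (T : Template) : (laneFrame T).z₀ = T.F.z₀ := by
  unfold laneFrame; split_ifs <;> rfl

/-- The lane pair in the lane frame is the template pair. [folklore] -/
theorem laneFrame_pair (T : Template) :
    (laneFrame T).fr (lα T) (lβ T + 1) = T.F.fr T.α (T.β + 1) ∧ (laneFrame T).fr (lα T + 1) (lβ T) = T.F.fr (T.α + 1) T.β ∨
    (laneFrame T).fr (lα T) (lβ T + 1) = T.F.fr (T.α + 1) T.β ∧ (laneFrame T).fr (lα T + 1) (lβ T) = T.F.fr T.α (T.β + 1) := by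
  unfold laneFrame lα lβ
  split_ifs
  · exact Or.inl ⟨rfl, rfl⟩
  · right; simp [Frame.swap_fr]

variable (m r) in
/-- The arena radius `A = h + r`. [folklore] -/
def A : ℤ := OddTile.hw m r + r

variable (m r) in
/-- The arena of `t'` as a rectangle in the frame `F` centred at `L t'`. [folklore] -/
def rect (F : Frame) : Rect where
  F := F
  xl := Frame.axLo (A m r) F.ex
  xr := Frame.axLo (A m r) F.ex + 2 * A m r + 1
  yl := Frame.axLo (A m r) F.ey
  yu := Frame.axLo (A m r) F.ey + 2 * A m r + 1
  hx := by
    have : 0 ≤ A m r := by unfold A; positivity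
    omega
  hy := by
    have : 0 ≤ A m r := by unfold A; positivity
    omega

/-- The frame of the arena rectangle. [folklore] -/
@[simp] theorem rect_F (F : Frame) : (rect m r F).F = F := rfl

/-- Bounds of the arena rectangle: `xl ∈ {-(A+1), -A}`, `xr = xl + 2A + 1 ∈ {A, A+1}`, and the
same for the ordinates; in particular `xl ≤ -A < 0 < A ≤ xr`. [folklore] -/
theorem rect_bounds (F : Frame) :
    ((rect m r F).xl = -(A m r + 1) ∨ (rect m r F).xl = -A m r) ∧ (rect m r F).xr = (rect m r F).xl + 2 * A m r + 1 ∧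
      ((rect m r F).yl = -(A m r + 1) ∨ (rect m r F).yl = -A m r) ∧ (rect m r F).yu = (rect m r F).yl + 2 * A m r + 1 ∧
      1 ≤ A m r := by
  classical
  refine ⟨?_, rfl, ?_, rfl, ?_⟩
  · simp only [rect, Frame.axLo]; split_ifs <;> simp
  · simp only [rect, Frame.axLo]; split_ifs <;> simp
  · unfold A; rw [OddTile.hw_eq]; omega

/-- Membership in the arena is membership in the rectangle (in frame coordinates). [folklore] -/
theorem fr_mem_arena_iff_rect (F : Frame) {t' : Site 2} (hz : F.z₀ = OddTile.ctr m r t') (a b : ℤ) :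
    F.fr a b ∈ OddTile.arena m r t' ↔
      (rect m r F).xl ≤ a ∧ a ≤ (rect m r F).xr ∧ (rect m r F).yl ≤ b ∧ b ≤ (rect m r F).yu := by
  rw [F.fr_mem_arena_iff hz]; rfl

/-- A site is in the arena iff its frame coordinates are in the rectangle. [folklore] -/
theorem mem_arena_iff_rect (F : Frame) {t' : Site 2} (hz : F.z₀ = OddTile.ctr m r t') (w : Site 2) :
    w ∈ OddTile.arena m r t' ↔
      (rect m r F).xl ≤ F.fx w ∧ F.fx w ≤ (rect m r F).xr ∧ (rect m r F).yl ≤ F.fy w ∧ F.fy w ≤ (rect m r F).yu := by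
  conv_lhs => rw [← F.fr_fx_fy w]
  exact fr_mem_arena_iff_rect F hz _ _

/-- Boundary sites of the rectangle are in the arena. [folklore] -/
theorem mem_arena_of_onBdry (F : Frame) {t' : Site 2} (hz : F.z₀ = OddTile.ctr m r t') {w : Site 2}
    (h : (rect m r F).OnBdry w) : w ∈ OddTile.arena m r t' := by
  rw [mem_arena_iff_rect F hz]
  exact ⟨h.1, h.2.1, h.2.2.1, h.2.2.2.1⟩

/-! ### Template complements -/

/-- The lane ordinate of a well-formed template is non-negative. [folklore] -/
theorem _root_.Literature.Probability.RandomPlanarGeometry.SAW.Template.β_nonneg (T : Template) {d₀ : ℤ}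
    (hd : 3 ≤ d₀) (h : T.WF d₀) : 0 ≤ T.β := by
  cases hs : T.shape <;> simp only [Template.WF, hs] at h <;> simp only [Template.β, hs] <;> omega

/-- In the transposed case the abscissa exceeds the ordinate, so `α ≥ β`; in the direct case
`β ≥ α - 1`… precisely: the lane ordinate is at least `(d₀ - 4)/2`. [folklore] -/
theorem two_mul_lβ_ge (T : Template) {d₀ : ℤ} (hd : 3 ≤ d₀) (h : T.WF d₀) : d₀ - 4 ≤ 2 * lβ T := by
  have hab := T.α_add_β h
  unfold lβ
  cases hs : T.shape <;> simp only [Template.WF, hs] at h <;> simp only [Template.α, Template.β, hs] at hab ⊢ <;>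
    split_ifs <;> omega

/-- The lane abscissa is non-negative. [folklore] -/
theorem lα_nonneg (T : Template) {d₀ : ℤ} (hd : 3 ≤ d₀) (h : T.WF d₀) : 0 ≤ lα T := by
  have := T.α_add_β h; have := T.β_nonneg hd h
  unfold lα; split_ifs <;> omega

/-- `lα + lβ = d₀ - 2`. [folklore] -/
theorem lα_add_lβ (T : Template) {d₀ : ℤ} (h : T.WF d₀) : lα T + lβ T = d₀ - 2 := by
  have := T.α_add_β h
  unfold lα lβ; split_ifs <;> omega

/-! ### The data of a splice and the derived objects -/

variable (m r) in
/-- The data of a splice: a well-formed template at the centre of the empty tile `t'`, the port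
side `dp`, the structure `S`, the sphere radius `d₀ ≥ 2A + 12`. [folklore] -/
structure Data where
  /-- the template -/
  T : Template
  /-- the empty tile -/
  t' : Site 2
  /-- the side of `t'` facing the tile carrying the port -/
  dp : Dir
  /-- the structure to insert -/
  S : List (Site 2)
  /-- the sphere radius -/
  d₀ : ℤ
  /-- the template is well formed -/
  wf : T.WF d₀
  /-- the template frame is centred at the tile centre -/
  hz₀ : T.F.z₀ = OddTile.ctr m r t'
  /-- the sphere is large compared to the arena -/
  big : 2 * A m r + 12 ≤ d₀

namespace Data

variable (X : Data m r)

/-- `d₀ ≥ 3`. [folklore] -/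
theorem three_le_d₀ : 3 ≤ X.d₀ := by
  have := X.big; have := (rect_bounds (m := m) (r := r) X.T.F).2.2.2.2; omega

/-- The arena rectangle in the lane frame. [folklore] -/
def Q : Rect := rect m r (laneFrame X.T)

/-- The lane data. [folklore] -/
def LD : LaneData where
  F := laneFrame X.T
  α := lα X.T
  β := lβ X.T
  xr := X.Q.xr
  yu := X.Q.yu
  hα := lα_nonneg X.T X.three_le_d₀ X.wf
  hxr := by
    have := rect_bounds (m := m) (r := r) (laneFrame X.T)
    show 0 < (rect m r (laneFrame X.T)).xr
    omega
  hyu := by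
    have := rect_bounds (m := m) (r := r) (laneFrame X.T)
    show 0 ≤ (rect m r (laneFrame X.T)).yu
    omega
  hβ := by
    have := rect_bounds (m := m) (r := r) (laneFrame X.T)
    have := two_mul_lβ_ge X.T X.three_le_d₀ X.wf
    have := X.big
    show (rect m r (laneFrame X.T)).yu + 1 ≤ lβ X.T
    omega

/-- The site facing `portA` of the port, one step into the arena. [folklore] -/
def pa : Site 2 := OddTile.portA m r (X.t' + X.dp.vec) X.dp.neg + X.dp.neg.vec

/-- The site facing `portB` of the port. [folklore] -/
def pb : Site 2 := OddTile.portB m r (X.t' + X.dp.vec) X.dp.neg + X.dp.neg.vec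

/-- The index of the left arrival on the boundary cycle. [folklore] -/
def i₀ : ℤ := X.Q.idx X.LD.arrL

/-- The index of the clockwise-first port site. [folklore] -/
def j : ℤ := if X.Q.idx X.pb ≡ X.Q.idx X.pa + 1 [ZMOD X.Q.P] then X.Q.idx X.pa else X.Q.idx X.pb

/-- The clockwise route (from the right arrival). [folklore] -/
def rCW : List (Site 2) := X.Q.routeCW X.i₀ X.j

/-- The counter-clockwise route (from the left arrival). [folklore] -/
def rCCW : List (Site 2) := X.Q.routeCCW X.i₀ X.j

/-- The structure, oriented to start next to the end of the counter-clockwise route. [folklore] -/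
def M : List (Site 2) := if X.rCCW.getLast? = some X.pa then X.S else X.S.reverse

/-- The path from the left point of the pair, down the left lane, along the counter-clockwise
route, through the structure, back along the clockwise route and up the right lane to the
right point of the pair. [folklore] -/
def path : List (Site 2) :=
  X.LD.laneL ++ X.rCCW.tail ++ X.M ++ X.rCW.reverse ++ X.LD.laneR.reverse.tail

/-- The excursion, oriented to start at `i₁` (and end at `i₂`). [folklore] -/
def exc : List (Site 2) := by
  classical
  exact if X.T.i₁ = X.LD.Lpt then X.path else X.path.reverse

/-- The inserted stretch: the excursion followed by the template tail. [folklore] -/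
def ins : List (Site 2) := X.exc ++ X.T.tail

/-- The sites of the lanes and of the template tail (which the structure must avoid).
[folklore] -/
def pathSites : Finset (Site 2) := (X.LD.laneL ++ X.LD.laneR ++ X.T.tail).toFinset

/-- The spliced list: the stretch `g :: mid ++ [s₂]` of `l` (in the direction in which it occurs)
with `mid` replaced by the inserted stretch. [cite: DuminilCopinKozmaYadin2014, §3 (proof of Proposition 7: the map f)] -/
def newList (l : List (Site 2)) : List (Site 2) :=
  if X.T.seg <:+: l then
    l.takeWhile (fun w => !decide (w = X.T.g)) ++ X.T.g :: X.ins ++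
      ((l.dropWhile fun w => !decide (w = X.T.g)).drop (1 + X.T.mid.length))
  else
    l.takeWhile (fun w => !decide (w = X.T.s₂)) ++ X.T.s₂ :: X.ins.reverse ++
      ((l.dropWhile fun w => !decide (w = X.T.s₂)).drop (1 + X.T.mid.length))

/-! ### Geometry of the port sites and arrivals -/

/-- The lane frame is centred at the tile centre. [folklore] -/
theorem hzL : (laneFrame X.T).z₀ = OddTile.ctr m r X.t' := by rw [laneFrame_z₀, X.hz₀]

/-- The two port sites are adjacent. [folklore] -/
theorem adj_pa_pb : (zdGraph 2).Adj X.pa X.pb := by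
  have := OddTile.adj_portA_portB (m := m) (r := r) (X.t' + X.dp.vec) X.dp.neg
  have := (zdGraph_adj_shift_iff X.dp.neg.vec _ _).2 this
  simpa [LatticeModels.Site.shift, pa, pb] using this

/-- The port sites are in the arena. [folklore] -/
theorem pa_pb_mem_arena : X.pa ∈ OddTile.arena m r X.t' ∧ X.pb ∈ OddTile.arena m r X.t' :=
  OddTile.port_steps_mem_arena X.t' X.dp

/-- The port sites are on the boundary of the arena rectangle (in any frame at the tile centre).
[folklore] -/
theorem onBdry_pa_pb (F : Frame) (hz : F.z₀ = OddTile.ctr m r X.t') :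
    (rect m r F).OnBdry X.pa ∧ (rect m r F).OnBdry X.pb := by
  classical
  have hA := X.pa_pb_mem_arena
  rw [mem_arena_iff_rect F hz, mem_arena_iff_rect F hz] at hA
  have cA := OddTile.portA_step_coords (m := m) (r := r) X.t' X.dp
  have cB := OddTile.portB_step_coords (m := m) (r := r) X.t' X.dp
  have hne1 : ¬Frame.AxPos (pt (-1) 0) := by simp [Frame.AxPos, site_eq_iff]
  have hne2 : ¬Frame.AxPos (pt 0 (-1)) := by simp [Frame.AxPos, site_eq_iff]
  have hp1 : Frame.AxPos (pt 1 0) := Or.inl rfl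
  have hp2 : Frame.AxPos (pt 0 1) := Or.inr rfl
  refine ⟨⟨hA.1.1, hA.1.2.1, hA.1.2.2.1, hA.1.2.2.2, ?_⟩, ⟨hA.2.1, hA.2.2.1, hA.2.2.2.1, hA.2.2.2.2, ?_⟩⟩ <;>
  · simp only [rect, Frame.fx, Frame.fy, hz, OddTile.ctr_apply, A]
    cases hd : X.dp <;> simp only [hd, pa, pb] at cA cB ⊢ <;>
      rcases F.valid with ⟨h1, h2 | h2⟩ | ⟨h1, h2 | h2⟩ | ⟨h1, h2 | h2⟩ | ⟨h1, h2 | h2⟩ <;>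
      simp only [h1, h2, Frame.axLo, hp1, hp2, hne1, hne2, if_true, if_false, pt_apply_zero,
        pt_apply_one, mul_one, mul_zero, mul_neg, add_zero, zero_add] <;> omega

/-- The arrivals are on the boundary, on the top row. [folklore] -/
theorem onBdry_arr : X.Q.OnBdry X.LD.arrL ∧ X.Q.OnBdry X.LD.arrR ∧
    X.Q.idx X.LD.arrR = X.Q.idx X.LD.arrL + 1 := by
  have hb := rect_bounds (m := m) (r := r) (laneFrame X.T)
  have hα := lα_nonneg X.T X.three_le_d₀ X.wf
  set xr := (rect m r (laneFrame X.T)).xr with hxr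
  have e1 : (laneFrame X.T).fx X.LD.arrL = min (lα X.T) (xr - 1) := by simp [LD, LaneData.arrL, Q, hxr]
  have e2 : (laneFrame X.T).fy X.LD.arrL = (rect m r (laneFrame X.T)).yu := by simp [LD, LaneData.arrL, Q]
  have e3 : (laneFrame X.T).fx X.LD.arrR = min (lα X.T + 1) xr := by simp [LD, LaneData.arrR, Q, hxr]
  have e4 : (laneFrame X.T).fy X.LD.arrR = (rect m r (laneFrame X.T)).yu := by simp [LD, LaneData.arrR, Q]
  have m1 : min (lα X.T) (xr - 1) ≤ xr - 1 := min_le_right _ _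
  have m2 : 0 ≤ min (lα X.T) (xr - 1) := le_min hα (by omega)
  have m5 : min (lα X.T + 1) xr = min (lα X.T) (xr - 1) + 1 := by
    rcases le_or_gt (lα X.T + 1) xr with h | h
    · rw [min_eq_left h, min_eq_left (by omega)]
    · rw [min_eq_right h.le, min_eq_right (by omega)]; ring
  simp only [Q, Rect.OnBdry, Rect.idx, rect_F, e1, e2, e3, e4]
  refine ⟨⟨by omega, by omega, by omega, le_rfl, Or.inr (Or.inr (Or.inr trivial))⟩,
    ⟨by omega, by omega, by omega, le_rfl, Or.inr (Or.inr (Or.inr trivial))⟩, ?_⟩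
  simp only [if_true]
  omega

/-- The boundary cycle at the arrival indices. [folklore] -/
theorem cyc_i₀ : X.Q.cyc X.i₀ = X.LD.arrL ∧ X.Q.cyc (X.i₀ + 1) = X.LD.arrR := by
  obtain ⟨hL, hR, hidx⟩ := X.onBdry_arr
  refine ⟨X.Q.cyc_idx hL, ?_⟩
  rw [i₀, ← hidx]; exact X.Q.cyc_idx hR

/-- The boundary cycle at the port indices: `{cyc j, cyc (j+1)} = {pa, pb}`. [folklore] -/
theorem cyc_j : (X.Q.cyc X.j = X.pa ∧ X.Q.cyc (X.j + 1) = X.pb) ∨ (X.Q.cyc X.j = X.pb ∧ X.Q.cyc (X.j + 1) = X.pa) := by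
  obtain ⟨hpa, hpb⟩ := X.onBdry_pa_pb (laneFrame X.T) X.hzL
  have hb := rect_bounds (m := m) (r := r) (laneFrame X.T)
  have hW : 2 ≤ X.Q.W := by simp only [Q, Rect.W]; omega
  have hH : 2 ≤ X.Q.H := by simp only [Q, Rect.H]; omega
  rw [j]
  split_ifs with h
  · exact Or.inl ⟨X.Q.cyc_idx hpa, X.Q.cyc_idx_succ hpb h⟩
  · rcases X.Q.idx_of_adj hW hH hpa hpb X.adj_pa_pb with h' | h'
    · exact absurd h' h
    · exact Or.inr ⟨X.Q.cyc_idx hpb, X.Q.cyc_idx_succ hpa h'⟩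

/-! ### Two gluing lemmas -/

/-- Gluing two chains that overlap in one vertex. [folklore] -/
theorem _root_.Literature.Probability.RandomPlanarGeometry.SAW.isChain_append_tail {V : Type*} {R : V → V → Prop}
    {A B : List V} (hA : A.IsChain R) (hB : B.IsChain R) (h : A.getLast? = B.head?) (hA0 : A ≠ []) :
    (A ++ B.tail).IsChain R := by
  cases B with
  | nil => simpa using hA
  | cons b B =>
    simp only [List.head?_cons] at h
    obtain ⟨init, rfl⟩ := List.getLast?_eq_some_iff.1 h
    simpa [List.append_assoc] using List.IsChain.append_overlap (l₂ := [b]) hA hB (by simp)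

/-- The last vertex of `A ++ B.tail` when they overlap. [folklore] -/
theorem _root_.Literature.Probability.RandomPlanarGeometry.SAW.getLast?_append_tail {V : Type*} {A B : List V}
    (h : A.getLast? = B.head?) (hA0 : A ≠ []) : (A ++ B.tail).getLast? = B.getLast? := by
  cases B with
  | nil => simp at h; exact absurd h hA0
  | cons b B =>
    cases B with
    | nil => simpa using h
    | cons c B =>
      have e : (c :: B).getLast? = some ((c :: B).getLast (List.cons_ne_nil _ _)) :=
        List.getLast?_eq_some_getLast _
      simp [List.getLast?_append, e]

/-! ### The hypotheses of the splice -/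

/-- The hypotheses under which the spliced list is again a self-avoiding walk: `l` is a
self-avoiding walk in `D` from `u` to `v` to which the template applies, the open ball of radius
`d₀` is free, the structure `S` is a self-avoiding chain between the two port vertices lying in
`D`, off `l`, off the arena and off the lanes and tail, and `D` contains the lanes, the tail and
the arena. [cite: DuminilCopinKozmaYadin2014, §3 (proof of Proposition 7)] -/
structure Hyp (D : Finset (Site 2)) (u v : Site 2) (l : List (Site 2)) : Prop where
  /-- the walk -/
  mem : l ∈ domSawLists (zdGraph 2) D u v
  /-- the template applies -/
  holds : X.T.Holds l
  /-- the open ball is free -/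
  free : ∀ w ∈ l, X.d₀ ≤ l1dist w X.T.F.z₀
  /-- the structure is a chain -/
  Schain : X.S.IsChain (zdGraph 2).Adj
  /-- without repetition -/
  Snodup : X.S.Nodup
  /-- from `portA` -/
  Shead : X.S.head? = some (OddTile.portA m r (X.t' + X.dp.vec) X.dp.neg)
  /-- to `portB` -/
  Slast : X.S.getLast? = some (OddTile.portB m r (X.t' + X.dp.vec) X.dp.neg)
  /-- inside the domain -/
  SD : ∀ w ∈ X.S, w ∈ D
  /-- off the walk -/
  Sl : ∀ w ∈ X.S, w ∉ l
  /-- off the arena -/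
  Sarena : ∀ w ∈ X.S, w ∉ OddTile.arena m r X.t'
  /-- off the lanes and the tail -/
  Spath : ∀ w ∈ X.S, w ∉ X.pathSites
  /-- the domain contains the lanes and the tail -/
  Dpath : ∀ w ∈ X.pathSites, w ∈ D
  /-- the domain contains the arena -/
  Darena : ∀ w ∈ OddTile.arena m r X.t', w ∈ D

/-! ### Properties of the pieces -/

/-- Lane sites are strictly inside the ball (hence off the walk and off the sphere). [folklore] -/
theorem l1dist_lane {w : Site 2} (h : w ∈ X.LD.laneL ∨ w ∈ X.LD.laneR) : l1dist w X.T.F.z₀ ≤ X.d₀ - 1 := by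
  have hsum := lα_add_lβ X.T X.wf
  rw [← laneFrame_z₀, (laneFrame X.T).l1dist_eq_frame]
  rcases h with h | h
  · obtain ⟨h1, h2, h3, h4, h5, -⟩ := X.LD.mem_laneL h
    have hyu := X.LD.hyu
    simp only [LD] at h1 h2 h3 h4 h5 hyu
    rw [abs_of_nonneg h1, abs_of_nonneg (by omega)]
    omega
  · obtain ⟨h1, h2, h3, h4, h5, -⟩ := X.LD.mem_laneR h
    have hyu := X.LD.hyu
    simp only [LD] at h1 h2 h3 h4 h5 hyu
    rw [abs_of_nonneg (by omega), abs_of_nonneg (by omega)]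
    omega

/-- Route sites are in the arena. [folklore] -/
theorem mem_arena_route {w : Site 2} (h : w ∈ X.rCW ∨ w ∈ X.rCCW) : w ∈ OddTile.arena m r X.t' := by
  have hsp := X.Q.routes_spec X.i₀ X.j
  rcases h with h | h
  · exact mem_arena_of_onBdry _ X.hzL (hsp.2.2.2.2.2.2.2.2.1 w h)
  · exact mem_arena_of_onBdry _ X.hzL (hsp.2.2.2.2.2.2.2.2.2 w h)

/-- Arena sites are strictly inside the ball. [folklore] -/
theorem l1dist_arena {w : Site 2} (h : w ∈ OddTile.arena m r X.t') : l1dist w X.T.F.z₀ ≤ X.d₀ - 1 := by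
  have := OddTile.l1dist_le_of_mem_arena h
  rw [X.hz₀]
  have hb := X.big
  unfold A at hb
  omega

/-- The structure, oriented either way, as a set, is `S`; it is a chain without repetition.
[folklore] -/
theorem M_spec {D : Finset (Site 2)} {u v : Site 2} {l : List (Site 2)} (H : X.Hyp D u v l) :
    (∀ w, w ∈ X.M ↔ w ∈ X.S) ∧ X.M.IsChain (zdGraph 2).Adj ∧ X.M.Nodup ∧ X.M ≠ [] ∧
      ((X.rCCW.getLast? = some X.pa ∧ X.M.head? = some (OddTile.portA m r (X.t' + X.dp.vec) X.dp.neg) ∧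
          X.M.getLast? = some (OddTile.portB m r (X.t' + X.dp.vec) X.dp.neg) ∧ X.rCW.getLast? = some X.pb) ∨
        (X.rCCW.getLast? = some X.pb ∧ X.M.head? = some (OddTile.portB m r (X.t' + X.dp.vec) X.dp.neg) ∧
          X.M.getLast? = some (OddTile.portA m r (X.t' + X.dp.vec) X.dp.neg) ∧ X.rCW.getLast? = some X.pa)) := by
  have hne : X.S ≠ [] := fun h => by have := H.Shead; rw [h] at this; simp at this
  have hsp := (X.Q.routes_spec X.i₀ X.j).2.2.2.2.2.2.1
  have hj := X.cyc_j
  -- which port site ends the counter-clockwise route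
  have hends : (X.rCCW.getLast? = some X.pa ∧ X.rCW.getLast? = some X.pb) ∨
      (X.rCCW.getLast? = some X.pb ∧ X.rCW.getLast? = some X.pa) := by
    simp only [rCW, rCCW]
    rcases hsp with ⟨h1, h2⟩ | ⟨h1, h2⟩ <;> rcases hj with ⟨h3, h4⟩ | ⟨h3, h4⟩
    · rw [h1, h2, h3, h4]; exact Or.inr ⟨rfl, rfl⟩
    · rw [h1, h2, h3, h4]; exact Or.inl ⟨rfl, rfl⟩
    · rw [h1, h2, h3, h4]; exact Or.inl ⟨rfl, rfl⟩
    · rw [h1, h2, h3, h4]; exact Or.inr ⟨rfl, rfl⟩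
  have hpapb : X.pa ≠ X.pb := X.adj_pa_pb.ne
  rcases hends with ⟨h1, h2⟩ | ⟨h1, h2⟩
  · have hM : X.M = X.S := by rw [M, if_pos h1]
    rw [hM]
    exact ⟨fun w => Iff.rfl, H.Schain, H.Snodup, hne, Or.inl ⟨h1, H.Shead, H.Slast, h2⟩⟩
  · have hM : X.M = X.S.reverse := by
      rw [M, if_neg]; rw [h1]; simpa using hpapb.symm
    rw [hM]
    refine ⟨fun w => List.mem_reverse, List.isChain_reverse.2 (H.Schain.imp fun _ _ h => h.symm),
      List.nodup_reverse.2 H.Snodup, by simpa using hne, Or.inr ⟨h1, ?_, ?_, h2⟩⟩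
    · rw [List.head?_reverse, H.Slast]
    · rw [List.getLast?_reverse, H.Shead]

/-- Membership in the path. [folklore] -/
theorem mem_path {w : Site 2} (h : w ∈ X.path) :
    w ∈ X.LD.laneL ∨ w ∈ X.rCCW ∨ w ∈ X.M ∨ w ∈ X.rCW ∨ w ∈ X.LD.laneR := by
  simp only [path, List.mem_append, List.mem_reverse] at h
  rcases h with (((h | h) | h) | h) | h
  · exact Or.inl h
  · exact Or.inr (Or.inl (List.mem_of_mem_tail h))
  · exact Or.inr (Or.inr (Or.inl h))
  · exact Or.inr (Or.inr (Or.inr (Or.inl h)))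
  · exact Or.inr (Or.inr (Or.inr (Or.inr (List.mem_reverse.1 (List.mem_of_mem_tail h)))))

/-- A site and its translate by a direction vector are adjacent. [folklore] -/
theorem _root_.Literature.Probability.RandomPlanarGeometry.SAW.adj_add_dirVec (x : Site 2) (d : Dir) :
    (zdGraph 2).Adj x (x + d.vec) := by
  have := (zdGraph_adj_shift_iff x 0 d.vec).2 (Dir.adj_zero_vec d)
  simpa [LatticeModels.Site.shift, add_comm] using this

/-- **The path is a chain** from the left point of the pair to the right one. [folklore] -/
theorem path_chain {D : Finset (Site 2)} {u v : Site 2} {l : List (Site 2)} (H : X.Hyp D u v l) :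
    X.path.IsChain (zdGraph 2).Adj ∧ X.path.head? = some X.LD.Lpt ∧ X.path.getLast? = some X.LD.Rpt := by
  obtain ⟨hcL, hcR, hnL, hnR, hhL, hhR, hlL, hlR, hdis, hneL, hneR⟩ := X.LD.lanes_spec
  obtain ⟨hc1, hc2, hn1, hn2, hh1, hh2, -, -, -, -⟩ := X.Q.routes_spec X.i₀ X.j
  obtain ⟨hMset, hMc, hMn, hMne, hMends⟩ := X.M_spec H
  have hcyc := X.cyc_i₀
  have hadjA : (zdGraph 2).Adj X.pa (OddTile.portA m r (X.t' + X.dp.vec) X.dp.neg) := (adj_add_dirVec _ _).symm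
  have hadjB : (zdGraph 2).Adj (OddTile.portB m r (X.t' + X.dp.vec) X.dp.neg) X.pb := adj_add_dirVec _ _
  have hadjA' : (zdGraph 2).Adj (OddTile.portA m r (X.t' + X.dp.vec) X.dp.neg) X.pa := adj_add_dirVec _ _
  have hadjB' : (zdGraph 2).Adj X.pb (OddTile.portB m r (X.t' + X.dp.vec) X.dp.neg) := (adj_add_dirVec _ _).symm
  -- piece 1: left lane then counter-clockwise route
  have e1 : X.LD.laneL.getLast? = X.rCCW.head? := by rw [hlL, rCCW, hh2, hcyc.1]
  have hA : (X.LD.laneL ++ X.rCCW.tail).IsChain (zdGraph 2).Adj := isChain_append_tail hcL hc2 e1 hneL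
  have hAlast : (X.LD.laneL ++ X.rCCW.tail).getLast? = X.rCCW.getLast? := getLast?_append_tail e1 hneL
  -- piece 2: then the structure
  have hB : (X.LD.laneL ++ X.rCCW.tail ++ X.M).IsChain (zdGraph 2).Adj := by
    refine List.IsChain.append hA hMc fun x hx y hy => ?_
    rw [hAlast] at hx
    rcases hMends with ⟨h1, h2, -, -⟩ | ⟨h1, h2, -, -⟩ <;> rw [h1] at hx <;> rw [h2] at hy <;>
      simp only [Option.mem_def, Option.some.injEq] at hx hy <;> subst hx <;> subst hy
    · exact hadjA
    · exact hadjB'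
  have hBlast : (X.LD.laneL ++ X.rCCW.tail ++ X.M).getLast? = X.M.getLast? := by
    rw [List.getLast?_append_of_ne_nil _ hMne]
  -- piece 3: then the clockwise route backwards
  have hCW : X.rCW.reverse.IsChain (zdGraph 2).Adj := List.isChain_reverse.2 (hc1.imp fun _ _ h => h.symm)
  have hCWne : X.rCW.reverse ≠ [] := by simpa [rCW] using X.Q.routeCW_ne_nil X.i₀ X.j
  have hC : (X.LD.laneL ++ X.rCCW.tail ++ X.M ++ X.rCW.reverse).IsChain (zdGraph 2).Adj := by
    refine List.IsChain.append hB hCW fun x hx y hy => ?_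
    rw [hBlast] at hx
    rw [List.head?_reverse] at hy
    rcases hMends with ⟨-, -, h1, h2⟩ | ⟨-, -, h1, h2⟩ <;> rw [h1] at hx <;> rw [h2] at hy <;>
      simp only [Option.mem_def, Option.some.injEq] at hx hy <;> subst hx <;> subst hy
    · exact hadjB
    · exact hadjA'
  have hClast : (X.LD.laneL ++ X.rCCW.tail ++ X.M ++ X.rCW.reverse).getLast? = some X.LD.arrR := by
    rw [List.getLast?_append_of_ne_nil _ hCWne, List.getLast?_reverse, rCW, hh1, hcyc.2]
  -- piece 4: then the right lane backwards
  have hRv : X.LD.laneR.reverse.IsChain (zdGraph 2).Adj := List.isChain_reverse.2 (hcR.imp fun _ _ h => h.symm)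
  have e4 : (X.LD.laneL ++ X.rCCW.tail ++ X.M ++ X.rCW.reverse).getLast? = X.LD.laneR.reverse.head? := by
    rw [hClast, List.head?_reverse, hlR]
  have hD : X.path.IsChain (zdGraph 2).Adj := isChain_append_tail hC hRv e4 (by simp [hCWne])
  refine ⟨hD, ?_, ?_⟩
  · rw [path, List.append_assoc, List.append_assoc, List.append_assoc, List.head?_append_of_ne_nil _ hneL, hhL]
  · rw [path, getLast?_append_tail e4 (by simp [hCWne]), List.getLast?_reverse, hhR]

/-- The head of a list without repetition is not in its tail. [folklore] -/
theorem _root_.Literature.Probability.RandomPlanarGeometry.SAW.not_mem_tail_of_head? {V : Type*} {l : List V} {a : V}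
    (hl : l.Nodup) (h : l.head? = some a) : a ∉ l.tail := by
  cases l with
  | nil => simp at h
  | cons b t =>
    simp only [List.head?_cons, Option.some.injEq] at h
    subst h
    exact (List.nodup_cons.1 hl).1

/-- Membership in `pathSites`. [folklore] -/
theorem mem_pathSites {w : Site 2} : w ∈ X.pathSites ↔ w ∈ X.LD.laneL ∨ w ∈ X.LD.laneR ∨ w ∈ X.T.tail := by
  simp only [pathSites, List.mem_toFinset, List.mem_append, or_assoc]

/-- A lane site in the arena rectangle's rows is an arrival. [folklore] -/
theorem eq_arr_of_mem_arena {w : Site 2} (hw : w ∈ OddTile.arena m r X.t') :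
    (w ∈ X.LD.laneL → w = X.LD.arrL) ∧ (w ∈ X.LD.laneR → w = X.LD.arrR) := by
  have hb := (mem_arena_iff_rect (laneFrame X.T) X.hzL w).1 hw
  constructor
  · intro h
    obtain ⟨-, -, h3, -, -, h6, -⟩ := X.LD.mem_laneL h
    simp only [LD] at h3 h6 ⊢
    exact h6 (le_antisymm hb.2.2.2 h3)
  · intro h
    obtain ⟨-, -, h3, -, -, h6, -⟩ := X.LD.mem_laneR h
    simp only [LD] at h3 h6 ⊢
    exact h6 (le_antisymm hb.2.2.2 h3) hb.2.1

/-- **The path visits no site twice.** [folklore] -/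
theorem path_nodup {D : Finset (Site 2)} {u v : Site 2} {l : List (Site 2)} (H : X.Hyp D u v l) : X.path.Nodup := by
  obtain ⟨-, -, hnL, hnR, hhL, hhR, hlL, hlR, hdis, hneL, hneR⟩ := X.LD.lanes_spec
  obtain ⟨-, -, hn1, hn2, hh1, hh2, -, hdisR, -, -⟩ := X.Q.routes_spec X.i₀ X.j
  obtain ⟨hMset, -, hMn, -, -⟩ := X.M_spec H
  have hcyc := X.cyc_i₀
  have harrL : X.LD.arrL ∈ X.rCCW := List.mem_of_mem_head? (by rw [rCCW, hh2, hcyc.1]; rfl)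
  have harrR : X.LD.arrR ∈ X.rCW := List.mem_of_mem_head? (by rw [rCW, hh1, hcyc.2]; rfl)
  have hMS : ∀ w ∈ X.M, w ∉ OddTile.arena m r X.t' ∧ w ∉ X.LD.laneL ∧ w ∉ X.LD.laneR := fun w hw => by
    have hwS := (hMset w).1 hw
    have hp := H.Spath w hwS
    rw [mem_pathSites] at hp
    exact ⟨H.Sarena w hwS, fun h => hp (Or.inl h), fun h => hp (Or.inr (Or.inl h))⟩
  rw [path]
  refine List.nodup_append.2 ⟨List.nodup_append.2 ⟨List.nodup_append.2 ⟨List.nodup_append.2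
    ⟨hnL, hn2.sublist (List.tail_sublist _), ?_⟩, hMn, ?_⟩, List.nodup_reverse.2 hn1, ?_⟩,
    (List.nodup_reverse.2 hnR).sublist (List.tail_sublist _), ?_⟩
  · -- left lane vs counter-clockwise route (minus its head, the left arrival)
    intro w hw w' hw' heq; subst heq
    have hwr : w ∈ X.rCCW := List.mem_of_mem_tail hw'
    have := (X.eq_arr_of_mem_arena (X.mem_arena_route (Or.inr hwr))).1 hw
    subst this
    exact not_mem_tail_of_head? hn2 (by rw [hh2, hcyc.1]) hw'
  · -- (lane ++ route) vs structure
    intro w hw w' hw' heq; subst heq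
    obtain ⟨h1, h2, -⟩ := hMS w hw'
    rcases List.mem_append.1 hw with h | h
    · exact h2 h
    · exact h1 (X.mem_arena_route (Or.inr (List.mem_of_mem_tail h)))
  · -- vs clockwise route
    intro w hw w' hw' heq; subst heq
    rw [List.mem_reverse] at hw'
    rcases List.mem_append.1 hw with hw | hw
    · rcases List.mem_append.1 hw with hw | hw
      · have := (X.eq_arr_of_mem_arena (X.mem_arena_route (Or.inl hw'))).1 hw
        subst this
        exact hdisR hw' harrL
      · exact hdisR hw' (List.mem_of_mem_tail hw)
    · exact (hMS w hw).1 (X.mem_arena_route (Or.inl hw'))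
  · -- vs right lane (backwards, minus its head, the right arrival)
    intro w hw w' hw' heq; subst heq
    have hwR : w ∈ X.LD.laneR := List.mem_reverse.1 (List.mem_of_mem_tail hw')
    rcases List.mem_append.1 hw with hw | hw
    · rcases List.mem_append.1 hw with hw | hw
      · rcases List.mem_append.1 hw with hw | hw
        · exact hdis hw hwR
        · have hwr := List.mem_of_mem_tail hw
          have := (X.eq_arr_of_mem_arena (X.mem_arena_route (Or.inr hwr))).2 hwR
          subst this
          exact hdisR harrR hwr
      · exact (hMS w hw).2.2 hwR
    · rw [List.mem_reverse] at hw
      have := (X.eq_arr_of_mem_arena (X.mem_arena_route (Or.inl hw))).2 hwR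
      subst this
      refine not_mem_tail_of_head? (List.nodup_reverse.2 hnR) ?_ hw'
      rw [List.head?_reverse, hlR]

/-- **The excursion**: a self-avoiding chain from `i₁` to `i₂` with the sites of the path.
[folklore] -/
theorem exc_spec {D : Finset (Site 2)} {u v : Site 2} {l : List (Site 2)} (H : X.Hyp D u v l) :
    X.exc.IsChain (zdGraph 2).Adj ∧ X.exc.Nodup ∧ X.exc.head? = some X.T.i₁ ∧
      X.exc.getLast? = some X.T.i₂ ∧ (∀ w, w ∈ X.exc ↔ w ∈ X.path) ∧ X.exc.length = X.path.length := by
  classical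
  obtain ⟨hc, hh, hl⟩ := X.path_chain H
  have hn := X.path_nodup H
  have hpair := X.T.pair_eq
  have hlp := laneFrame_pair X.T
  have hne12 : X.T.i₁ ≠ X.T.i₂ := (X.T.geom X.three_le_d₀ X.wf).2.2.1
  have hLR : X.LD.Lpt = (laneFrame X.T).fr (lα X.T) (lβ X.T + 1) := rfl
  have hRR : X.LD.Rpt = (laneFrame X.T).fr (lα X.T + 1) (lβ X.T) := rfl
  by_cases h1 : X.T.i₁ = X.LD.Lpt
  · have hexc : X.exc = X.path := by rw [exc, if_pos h1]
    rw [hexc]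
    refine ⟨hc, hn, by rw [hh, h1], ?_, fun w => Iff.rfl, rfl⟩
    rw [hl]
    congr 1
    rw [hLR] at h1
    rw [hRR]
    rcases hpair with ⟨e1, e2⟩ | ⟨e1, e2⟩ <;> rcases hlp with ⟨f1, f2⟩ | ⟨f1, f2⟩
    · rw [f2, e2]
    · rw [f1, e1] at h1; rw [f2, e2]
      have := (X.T.geom X.three_le_d₀ X.wf).2.2.1
      rw [e1, e2, ← h1] at this
      exact absurd rfl this
    · rw [e1, f1] at h1
      have := (X.T.geom X.three_le_d₀ X.wf).2.2.1
      rw [e1, e2, h1] at this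
      exact absurd rfl this
    · rw [f2, e2]
  · have hexc : X.exc = X.path.reverse := by rw [exc, if_neg h1]
    rw [hexc]
    refine ⟨List.isChain_reverse.2 (hc.imp fun _ _ h => h.symm), List.nodup_reverse.2 hn, ?_, ?_,
      fun w => List.mem_reverse, List.length_reverse⟩
    · rw [List.head?_reverse, hl]
      congr 1
      rw [hLR] at h1; rw [hRR]
      rcases hpair with ⟨e1, e2⟩ | ⟨e1, e2⟩ <;> rcases hlp with ⟨f1, f2⟩ | ⟨f1, f2⟩
      · rw [f1, e1] at h1; exact absurd rfl h1
      · rw [f2, e1]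
      · rw [f2, e1]
      · rw [f1, e1] at h1; exact absurd rfl h1
    · rw [List.getLast?_reverse, hh]
      congr 1
      rw [hLR] at h1 ⊢
      rcases hpair with ⟨e1, e2⟩ | ⟨e1, e2⟩ <;> rcases hlp with ⟨f1, f2⟩ | ⟨f1, f2⟩
      · rw [f1, e1] at h1; exact absurd rfl h1
      · rw [f1, e2]
      · rw [f1, e2]
      · rw [f1, e1] at h1; exact absurd rfl h1

/-- Sites of the path other than the structure are strictly inside the ball. [folklore] -/
theorem l1dist_path {D : Finset (Site 2)} {u v : Site 2} {l : List (Site 2)} (H : X.Hyp D u v l) {w : Site 2}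
    (hw : w ∈ X.path) : w ∈ X.S ∨ l1dist w X.T.F.z₀ ≤ X.d₀ - 1 := by
  rcases X.mem_path hw with h | h | h | h | h
  · exact Or.inr (X.l1dist_lane (Or.inl h))
  · exact Or.inr (X.l1dist_arena (X.mem_arena_route (Or.inr h)))
  · exact Or.inl (((X.M_spec H).1 w).1 h)
  · exact Or.inr (X.l1dist_arena (X.mem_arena_route (Or.inl h)))
  · exact Or.inr (X.l1dist_lane (Or.inr h))

/-- **The inserted stretch**: `g :: ins ++ [s₂]` is a chain, `ins` has no repetition, is off the
walk and inside the domain. [folklore] -/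
theorem ins_spec {D : Finset (Site 2)} {u v : Site 2} {l : List (Site 2)} (H : X.Hyp D u v l) :
    (X.T.g :: X.ins ++ [X.T.s₂]).IsChain (zdGraph 2).Adj ∧ X.ins.Nodup ∧ (∀ w ∈ X.ins, w ∉ l) ∧
      (∀ w ∈ X.ins, w ∈ D) := by
  obtain ⟨hc, hn, hh, hl, hset, -⟩ := X.exc_spec H
  obtain ⟨g1, g2, g3, g4, g5, g6, -⟩ := X.T.geom X.three_le_d₀ X.wf
  have hne : X.exc ≠ [] := fun h => by rw [h] at hh; simp at hh
  -- the sites of `ins`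
  have hins : ∀ w ∈ X.ins, (w ∈ X.path ∨ w ∈ X.T.tail) := fun w hw => by
    rcases List.mem_append.1 hw with h | h
    · exact Or.inl ((hset w).1 h)
    · exact Or.inr h
  refine ⟨?_, ?_, fun w hw => ?_, fun w hw => ?_⟩
  · -- chain
    obtain ⟨rest, hrest⟩ : ∃ rest, X.exc = X.T.i₁ :: rest := by
      cases hx : X.exc with
      | nil => exact absurd hx hne
      | cons a rest => rw [hx] at hh; simp at hh; exact ⟨rest, by rw [hh]⟩
    have h1 : (X.T.g :: X.exc).IsChain (zdGraph 2).Adj := by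
      rw [hrest, List.isChain_cons_cons]; exact ⟨g1, hrest ▸ hc⟩
    have h2 : (X.T.g :: X.exc).getLast? = (X.T.i₂ :: (X.T.tail ++ [X.T.s₂])).head? := by
      rw [List.head?_cons, hrest, List.getLast?_cons_cons] ; rw [hrest] at hl; exact hl
    have := isChain_append_tail h1 g2 h2 (by simp)
    simpa [ins, List.append_assoc] using this
  · -- no repetition
    rw [ins, List.nodup_append]
    refine ⟨hn, ?_, fun w hw w' hw' heq => ?_⟩
    · cases hs : X.T.shape <;> simp [Template.tail, hs]
    · subst heq
      rw [hset] at hw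
      rcases X.l1dist_path H hw with h | h
      · exact H.Spath w h (X.mem_pathSites.2 (Or.inr (Or.inr hw')))
      · have := g6 w hw'; omega
  · -- off the walk
    rcases hins w hw with h | h
    · rcases X.l1dist_path H h with h' | h'
      · exact H.Sl w h'
      · intro hwl; have := H.free w hwl; omega
    · exact H.holds.2 w h
  · -- inside the domain
    rcases hins w hw with h | h
    · rcases X.mem_path h with h' | h' | h' | h' | h'
      · exact H.Dpath w (X.mem_pathSites.2 (Or.inl h'))
      · exact H.Darena w (X.mem_arena_route (Or.inr h'))
      · exact H.SD w (((X.M_spec H).1 w).1 h')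
      · exact H.Darena w (X.mem_arena_route (Or.inl h'))
      · exact H.Dpath w (X.mem_pathSites.2 (Or.inr (Or.inl h')))
    · exact H.Dpath w (X.mem_pathSites.2 (Or.inr (Or.inr h)))

/-- The two ways the template segment sits in the walk, with the corresponding form of the
spliced list. [folklore] -/
theorem newList_eq {D : Finset (Site 2)} {u v : Site 2} {l : List (Site 2)} (H : X.Hyp D u v l) :
    (∃ pre post, l = pre ++ X.T.g :: X.T.mid ++ X.T.s₂ :: post ∧
        X.newList l = pre ++ X.T.g :: X.ins ++ X.T.s₂ :: post ∧ X.T.seg <:+: l) ∨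
      (∃ pre post, l = pre ++ X.T.s₂ :: X.T.mid.reverse ++ X.T.g :: post ∧
        X.newList l = pre ++ X.T.s₂ :: X.ins.reverse ++ X.T.g :: post ∧ ¬X.T.seg <:+: l) := by
  have hnd := (mem_domSawLists.1 H.mem).1.nodup
  by_cases hseg : X.T.seg <:+: l
  · left
    obtain ⟨pre, post, hl⟩ := hseg
    have hl' : l = pre ++ X.T.g :: (X.T.mid ++ X.T.s₂ :: post) := by rw [← hl]; simp [Template.seg]
    have hg : X.T.g ∉ pre := fun h => by
      rw [hl'] at hnd
      exact (List.nodup_append.1 hnd).2.2 _ h _ (List.mem_cons_self ..) rfl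
    refine ⟨pre, post, by rw [hl']; simp, ?_, ⟨pre, post, hl⟩⟩
    rw [newList, if_pos ⟨pre, post, hl⟩, hl', takeWhile_ne_eq hg, dropWhile_ne_eq hg, Nat.add_comm,
      List.drop_succ_cons, List.drop_left]
  · right
    have hrev : X.T.seg.reverse <:+: l := H.holds.1.resolve_left hseg
    obtain ⟨pre, post, hl⟩ := hrev
    have hl' : l = pre ++ X.T.s₂ :: (X.T.mid.reverse ++ X.T.g :: post) := by
      rw [← hl]; simp [Template.seg, List.reverse_append]
    have hg : X.T.s₂ ∉ pre := fun h => by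
      rw [hl'] at hnd
      exact (List.nodup_append.1 hnd).2.2 _ h _ (List.mem_cons_self ..) rfl
    refine ⟨pre, post, by rw [hl']; simp, ?_, hseg⟩
    rw [newList, if_neg hseg, hl', takeWhile_ne_eq hg, dropWhile_ne_eq hg, Nat.add_comm,
      List.drop_succ_cons, ← X.T.mid.length_reverse, List.drop_left]

/-- **The spliced list is a self-avoiding walk in the domain with the same endpoints.**
[cite: DuminilCopinKozmaYadin2014, §3 (proof of Proposition 7: "f(γ₁, γ₂) ∈ Γ")] -/
theorem newList_mem {D : Finset (Site 2)} {u v : Site 2} {l : List (Site 2)} (H : X.Hyp D u v l) :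
    X.newList l ∈ domSawLists (zdGraph 2) D u v := by
  classical
  obtain ⟨hchain, hnodup, hfresh, hD⟩ := X.ins_spec H
  rcases X.newList_eq H with ⟨pre, post, hl, hnew, -⟩ | ⟨pre, post, hl, hnew, -⟩
  · rw [hnew]
    have hmem := H.mem; rw [hl] at hmem
    exact splice_mem_domSawLists hmem hchain hnodup (fun w hw => hl ▸ hfresh w hw) hD
  · rw [hnew]
    have hmem := H.mem; rw [hl] at hmem
    refine splice_mem_domSawLists hmem ?_ (List.nodup_reverse.2 hnodup)
      (fun w hw => hl ▸ hfresh w (List.mem_reverse.1 hw)) (fun w hw => hD w (List.mem_reverse.1 hw))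
    have := List.isChain_reverse.2 (hchain.imp fun _ _ h => h.symm)
    simpa using this

/-- Length of the lanes. [folklore] -/
theorem length_lanes_le : (X.LD.laneL.length : ℤ) ≤ X.d₀ + 1 ∧ (X.LD.laneR.length : ℤ) ≤ X.d₀ + 1 := by
  have hsum := lα_add_lβ X.T X.wf
  have hα := X.LD.hα; have hβ := X.LD.hβ; have hxr := X.LD.hxr; have hyu := X.LD.hyu
  simp only [LD] at hα hβ hxr hyu
  constructor
  · rw [LaneData.laneL]
    split_ifs with hV
    · simp only [LD, Frame.vDown, length_seg, Nat.cast_add, Nat.cast_one]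
      rw [Int.toNat_of_nonneg (by omega)]; omega
    · simp only [LD, LaneData.IsV] at hV
      simp only [LD, Frame.vDown, Frame.hWest, List.length_append, List.length_tail, length_seg,
        List.length_singleton, Nat.add_sub_cancel, Nat.cast_add, Nat.cast_one]
      rw [Int.toNat_of_nonneg (by omega), Int.toNat_of_nonneg (by omega)]; omega
  · rw [LaneData.laneR]
    split_ifs with hV
    · simp only [LD, Frame.vDown, length_seg, Nat.cast_add, Nat.cast_one]
      rw [Int.toNat_of_nonneg (by omega)]; omega
    · simp only [LD, LaneData.IsV] at hV
      simp only [LD, Frame.vDown, Frame.hWest, List.length_append, List.length_tail, length_seg,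
        Nat.add_sub_cancel, Nat.cast_add, Nat.cast_one]
      rw [Int.toNat_of_nonneg (by omega), Int.toNat_of_nonneg (by omega)]; omega

/-- Length of the routes. [folklore] -/
theorem length_routes_le : (X.rCW.length : ℤ) ≤ 4 * X.d₀ ∧ (X.rCCW.length : ℤ) ≤ 4 * X.d₀ := by
  have hb := rect_bounds (m := m) (r := r) (laneFrame X.T)
  have hbig := X.big
  have hP : X.Q.P ≤ 4 * X.d₀ := by
    simp only [Q, Rect.P, Rect.W, Rect.H]; omega
  obtain ⟨-, -, hn1, hn2, -⟩ := X.Q.routes_spec X.i₀ X.j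
  have hδ := X.Q.δ_bounds X.i₀ X.j
  constructor
  · have : (X.rCW.length : ℤ) = X.Q.nCW X.i₀ X.j + 1 := by simp [rCW, Rect.routeCW, Rect.cwArc]
    rw [this]
    simp only [Rect.nCW]; split_ifs <;> omega
  · have : (X.rCCW.length : ℤ) = X.Q.nCCW X.i₀ X.j + 1 := by simp [rCCW, Rect.routeCCW, Rect.ccwArc]
    rw [this]
    simp only [Rect.nCCW]; split_ifs <;> omega

/-- **Length of the spliced list**: `|l| + |S| ≤ |new| ≤ |l| + |S| + 10 d₀ + 3`. [folklore] -/
theorem length_newList {D : Finset (Site 2)} {u v : Site 2} {l : List (Site 2)} (H : X.Hyp D u v l) :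
    l.length + X.S.length ≤ (X.newList l).length ∧
      ((X.newList l).length : ℤ) ≤ l.length + X.S.length + 10 * X.d₀ + 3 := by
  obtain ⟨-, -, -, -, -, hlen⟩ := X.exc_spec H
  obtain ⟨-, -, -, hMne, -⟩ := X.M_spec H
  have hMlen : X.M.length = X.S.length := by rw [M]; split_ifs <;> simp
  have hgeom := X.T.geom X.three_le_d₀ X.wf
  have htail : X.T.tail.length ≤ 1 := hgeom.2.2.2.2.2.2.2.2.2.1
  have hmid : X.T.mid.length ≤ 1 := hgeom.2.2.2.2.2.2.2.2.2.2
  have hL := X.length_lanes_le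
  have hR := X.length_routes_le
  have hneL := X.LD.lanes_spec.2.2.2.2.2.2.2.2.2.1
  have hneCW : X.rCW ≠ [] := X.Q.routeCW_ne_nil _ _
  have hneCCW : X.rCCW ≠ [] := X.Q.routeCCW_ne_nil _ _
  have h1 := List.length_pos_of_ne_nil hneL
  have h2 := List.length_pos_of_ne_nil hneCW
  have h3 := List.length_pos_of_ne_nil hneCCW
  have hpath : X.path.length + 2 = X.LD.laneL.length + X.rCCW.length + X.S.length + X.rCW.length + X.LD.laneR.length := by
    simp only [path, List.length_append, List.length_tail, List.length_reverse, hMlen]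
    have := List.length_pos_of_ne_nil X.LD.lanes_spec.2.2.2.2.2.2.2.2.2.2
    omega
  have hins : X.ins.length = X.path.length + X.T.tail.length := by rw [ins, List.length_append, hlen]
  rcases X.newList_eq H with ⟨pre, post, hl, hnew, -⟩ | ⟨pre, post, hl, hnew, -⟩
  · have e := length_splice pre X.T.mid X.ins post X.T.g X.T.s₂
    rw [← hl, ← hnew] at e
    constructor
    · omega
    · omega
  · have e := length_splice pre X.T.mid.reverse X.ins.reverse post X.T.s₂ X.T.g
    rw [← hl, ← hnew, List.length_reverse, List.length_reverse] at e
    constructor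
    · omega
    · omega

end Data

end Splice

end Literature.Probability.RandomPlanarGeometry.SAW
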